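import Summits.CriticalPhenomena.Ising3DConformalLimit.Theorems.PerfectScreeningGaussianLimitNotScreenedRegressionDefs
import Summits.CriticalPhenomena.Ising3DConformalLimit.Theorems.PerfectScreeningGaussianLimitNotScreenedRieszKernelPosDef
import HarnessLib

/-!
# The continuum autocorrelation / Fubini identity of the double term (stub B2c)

Stub `stub_doubleTermFubini` (B2c) of line `single-layer-linear-regression` for the crux
`GaussianLimitNotScreened` (stmt-CriticalPhenomena-13886). THEOREM-ONLY, pure real analysis on
`ℝ² = E2 = EuclideanSpace ℝ (Fin 2)` (Lebesgue measure).

For a continuous profile `φ` vanishing on `{‖v‖ ≥ R}` and `1/2 ≤ Δ < 1`, the autocorrelation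
`Ψ(z) = ∫ φ(y) φ(y − z) dy` is

1. continuous (dominated convergence: the integrand is continuous in `z` and dominated by `M |φ|`);
2. zero for `‖z‖ ≥ 2R` (if `φ(y) ≠ 0` then `‖y‖ < R`, so `‖y − z‖ > R` and `φ(y − z) = 0`);
3. `∫_v ∫_w φ(v) φ(w) ‖v − w‖^{−2Δ} dw dv = ∫_z Ψ(z) ‖z‖^{−2Δ} dz`: the Riesz-energy integrand
   `φ(v) φ(w) ‖v − w‖^{−2Δ}` is integrable on `ℝ² × ℝ²` (landed C1 lemma `rieszPosDef_integrable_prod`),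
   the shear `(v, z) ↦ (v, v − z)` preserves Lebesgue measure on `ℝ² × ℝ²` (translation and reflection
   invariance), so the iterated integral is the product integral of `φ(v) φ(v − z) ‖z‖^{−2Δ}`, which is
   then evaluated in the order `dz dv ↦ dv dz` (Fubini) and the constant `‖z‖^{−2Δ}` pulled out.
-/

noncomputable section

namespace Summit.CriticalPhenomena.Ising3DConformalLimit.Cruxes.GaussianLimitNotScreened.SingleLayerLinearRegression

open MeasureTheory Filter Topology
open Literature.Probability.LatticeModels

/-! ### The profile: compact support, boundedness, and the support of the autocorrelation integrand -/

/-- A profile vanishing on `{‖v‖ ≥ R}` has compact support (inside the closed ball of radius `R`).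
[folklore] -/
theorem doubleTermFubini_hasCompactSupport {φ : E2 → ℝ} {R : ℕ}
    (hφR : ∀ v : E2, (R : ℝ) ≤ ‖v‖ → φ v = 0) : HasCompactSupport φ :=
  HasCompactSupport.intro (isCompact_closedBall (0 : E2) R) fun v hv =>
    hφR v (le_of_lt (by simpa [Metric.mem_closedBall, dist_zero_right] using hv))

/-- A continuous profile vanishing on `{‖v‖ ≥ R}` is integrable. [folklore] -/
theorem doubleTermFubini_integrable {φ : E2 → ℝ} {R : ℕ} (hφ : Continuous φ)
    (hφR : ∀ v : E2, (R : ℝ) ≤ ‖v‖ → φ v = 0) : Integrable φ :=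
  hφ.integrable_of_hasCompactSupport (doubleTermFubini_hasCompactSupport hφR)

/-- A continuous profile vanishing on `{‖v‖ ≥ R}` is bounded. [folklore] -/
theorem doubleTermFubini_exists_bound {φ : E2 → ℝ} {R : ℕ} (hφ : Continuous φ)
    (hφR : ∀ v : E2, (R : ℝ) ≤ ‖v‖ → φ v = 0) : ∃ M : ℝ, ∀ v, |φ v| ≤ M := by
  obtain ⟨C, hC⟩ := hφ.bounded_above_of_compact_support (doubleTermFubini_hasCompactSupport hφR)
  exact ⟨C, fun v => by simpa [Real.norm_eq_abs] using hC v⟩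

/-- For `‖z‖ ≥ 2R` the autocorrelation integrand `φ(y) φ(y − z)` vanishes identically: if
`φ(y) ≠ 0` then `‖y‖ < R`, hence `‖y − z‖ ≥ ‖z‖ − ‖y‖ > R`. [folklore] -/
theorem doubleTermFubini_mul_eq_zero {φ : E2 → ℝ} {R : ℕ}
    (hφR : ∀ v : E2, (R : ℝ) ≤ ‖v‖ → φ v = 0) {z : E2} (hz : 2 * (R : ℝ) ≤ ‖z‖) (y : E2) :
    φ y * φ (y - z) = 0 := by
  by_cases hy : (R : ℝ) ≤ ‖y‖
  · rw [hφR y hy, zero_mul]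
  · push Not at hy
    have h1 : ‖z‖ - ‖y‖ ≤ ‖y - z‖ := by
      rw [norm_sub_rev]
      exact norm_sub_norm_le z y
    rw [hφR (y - z) (by linarith), mul_zero]

/-! ### (1) Continuity of the autocorrelation -/

/-- The autocorrelation `z ↦ ∫ φ(y) φ(y − z) dy` of a continuous profile vanishing on `{‖v‖ ≥ R}`
is continuous (dominated convergence with the bound `M |φ|`). [folklore] -/
theorem doubleTermFubini_continuous {φ : E2 → ℝ} {R : ℕ} (hφ : Continuous φ)
    (hφR : ∀ v : E2, (R : ℝ) ≤ ‖v‖ → φ v = 0) :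
    Continuous (fun z : E2 => ∫ y : E2, φ y * φ (y - z)) := by
  obtain ⟨M, hM⟩ := doubleTermFubini_exists_bound hφ hφR
  have hint : Integrable φ := doubleTermFubini_integrable hφ hφR
  refine continuous_of_dominated (bound := fun y => M * ‖φ y‖) ?_ ?_ (hint.norm.const_mul M) ?_
  · intro z
    exact (hφ.mul (hφ.comp (continuous_id.sub continuous_const))).aestronglyMeasurable
  · intro z
    refine ae_of_all _ fun y => ?_
    rw [norm_mul, mul_comm]
    exact mul_le_mul_of_nonneg_right (by simpa [Real.norm_eq_abs] using hM (y - z)) (norm_nonneg _)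
  · exact ae_of_all _ fun y => continuous_const.mul (hφ.comp (continuous_const.sub continuous_id))

/-! ### (2) Support of the autocorrelation -/

/-- The autocorrelation of a profile vanishing on `{‖v‖ ≥ R}` vanishes on `{‖z‖ ≥ 2R}`. [folklore] -/
theorem doubleTermFubini_support {φ : E2 → ℝ} {R : ℕ}
    (hφR : ∀ v : E2, (R : ℝ) ≤ ‖v‖ → φ v = 0) (z : E2) (hz : ((2 * R : ℕ) : ℝ) ≤ ‖z‖) :
    ∫ y : E2, φ y * φ (y - z) = 0 := by
  have hz' : 2 * (R : ℝ) ≤ ‖z‖ := by push_cast at hz; exact hz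
  simp [doubleTermFubini_mul_eq_zero hφR hz']

/-! ### (3) The Fubini / translation identity -/

/-- The shear `(v, z) ↦ (v, v − z)` preserves Lebesgue measure on `ℝ² × ℝ²` (translation and
reflection invariance of Lebesgue measure on `ℝ²`, fibrewise). [folklore] -/
theorem doubleTermFubini_measurePreserving_shear :
    MeasurePreserving (fun p : E2 × E2 => (p.1, p.1 - p.2))
      ((volume : Measure E2).prod volume) ((volume : Measure E2).prod volume) :=
  (MeasurePreserving.id volume).skew_product (g := fun v z : E2 => v - z) measurable_sub
    (ae_of_all _ fun v => Measure.map_sub_left_eq_self volume v)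

/-- **The Fubini / translation identity**: for `0 < Δ < 1` and a continuous profile `φ` vanishing on
`{‖v‖ ≥ R}`, `∫_v ∫_w φ(v) φ(w) ‖v − w‖^{−2Δ} dw dv = ∫_z (∫_y φ(y) φ(y − z) dy) ‖z‖^{−2Δ} dz`
(product integrability from the landed C1 lemma `rieszPosDef_integrable_prod`, the measure-preserving
shear `(v, z) ↦ (v, v − z)`, and Fubini). [folklore] -/
theorem doubleTermFubini_identity {Δ : ℝ} (hΔ0 : 0 < Δ) (hΔ1 : Δ < 1) {φ : E2 → ℝ} {R : ℕ}
    (hφ : Continuous φ) (hφR : ∀ v : E2, (R : ℝ) ≤ ‖v‖ → φ v = 0) :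
    (∫ v : E2, ∫ w : E2, φ v * φ w * ‖v - w‖ ^ (-(2 * Δ))) =
      ∫ z : E2, (∫ y : E2, φ y * φ (y - z)) * ‖z‖ ^ (-(2 * Δ)) := by
  obtain ⟨M, hM⟩ := doubleTermFubini_exists_bound hφ hφR
  have hint : Integrable φ := doubleTermFubini_integrable hφ hφR
  -- integrability of the Riesz-energy integrand on the product (landed C1 lemma)
  have hG : Integrable (fun p : E2 × E2 => φ p.1 * φ p.2 * ‖p.1 - p.2‖ ^ (-(2 * Δ)))
      ((volume : Measure E2).prod volume) :=
    rieszPosDef_integrable_prod hΔ0 hΔ1 hφ hφ hint hint hM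
  have hT := doubleTermFubini_measurePreserving_shear
  -- integrability of the sheared integrand
  have hF : Integrable (fun p : E2 × E2 => φ p.1 * φ (p.1 - p.2) * ‖p.2‖ ^ (-(2 * Δ)))
      ((volume : Measure E2).prod volume) := by
    refine (hT.integrable_comp_of_integrable hG).congr (ae_of_all _ fun p => ?_)
    simp [Function.comp, sub_sub_cancel]
  -- change of variables in the product integral
  have hcov : ∫ p, φ p.1 * φ p.2 * ‖p.1 - p.2‖ ^ (-(2 * Δ)) ∂((volume : Measure E2).prod volume) =
      ∫ p, φ p.1 * φ (p.1 - p.2) * ‖p.2‖ ^ (-(2 * Δ)) ∂((volume : Measure E2).prod volume) := by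
    have h := integral_map (μ := (volume : Measure E2).prod volume) hT.measurable.aemeasurable
      (f := fun p : E2 × E2 => φ p.1 * φ p.2 * ‖p.1 - p.2‖ ^ (-(2 * Δ)))
      (by rw [hT.map_eq]; exact hG.aestronglyMeasurable)
    rw [hT.map_eq] at h
    rw [h]
    refine integral_congr_ae (ae_of_all _ fun p => ?_)
    simp [sub_sub_cancel]
  calc (∫ v : E2, ∫ w : E2, φ v * φ w * ‖v - w‖ ^ (-(2 * Δ)))
      = ∫ p, φ p.1 * φ p.2 * ‖p.1 - p.2‖ ^ (-(2 * Δ)) ∂((volume : Measure E2).prod volume) :=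
        (integral_prod _ hG).symm
    _ = ∫ p, φ p.1 * φ (p.1 - p.2) * ‖p.2‖ ^ (-(2 * Δ)) ∂((volume : Measure E2).prod volume) := hcov
    _ = ∫ z : E2, ∫ v : E2, φ v * φ (v - z) * ‖z‖ ^ (-(2 * Δ)) := integral_prod_symm _ hF
    _ = ∫ z : E2, (∫ y : E2, φ y * φ (y - z)) * ‖z‖ ^ (-(2 * Δ)) := by
        refine integral_congr_ae (ae_of_all _ fun z => ?_)
        exact integral_mul_const _ _

/-! ### The registered stub -/

/-- **Registered stub `stub_doubleTermFubini` (B2c)**: for `1/2 ≤ Δ < 1` and a continuous profile `φ`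
on `ℝ²` vanishing on `{‖v‖ ≥ R}`, the autocorrelation `Ψ(z) = ∫ φ(y) φ(y − z) dy` is continuous,
vanishes for `‖z‖ ≥ 2R`, and `∫_v ∫_w φ(v) φ(w) ‖v − w‖^{−2Δ} dw dv = ∫_z Ψ(z) ‖z‖^{−2Δ} dz`.
[folklore] -/
theorem stub_doubleTermFubini :
    ∀ Δ : ℝ, 1 / 2 ≤ Δ → Δ < 1 → ∀ (φ : E2 → ℝ) (R : ℕ), Continuous φ →
      (∀ v : E2, (R : ℝ) ≤ ‖v‖ → φ v = 0) →
      Continuous (fun z : E2 => ∫ y : E2, φ y * φ (y - z)) ∧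
      (∀ z : E2, ((2 * R : ℕ) : ℝ) ≤ ‖z‖ → ∫ y : E2, φ y * φ (y - z) = 0) ∧
      (∫ v : E2, ∫ w : E2, φ v * φ w * ‖v - w‖ ^ (-(2 * Δ))) =
        ∫ z : E2, (∫ y : E2, φ y * φ (y - z)) * ‖z‖ ^ (-(2 * Δ)) := by
  intro Δ hΔ hΔ1 φ R hφ hφR
  exact ⟨doubleTermFubini_continuous hφ hφR, doubleTermFubini_support hφR,
    doubleTermFubini_identity (by linarith) hΔ1 hφ hφR⟩

end Summit.CriticalPhenomena.Ising3DConformalLimit.Cruxes.GaussianLimitNotScreened.SingleLayerLinearRegression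

end
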